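import Summits.QuantumFields.BalabanUV.T4Continuum.Support.NE3TangentCovariantStructure
import Summits.QuantumFields.BalabanUV.T4Continuum.Support.BlockAverageDbarLinBound
import HarnessLib

/-!
# T⁴ programme, node NE3, row E-MLw-(w4)-P · C1 (file 1) — THE COVARIANT STRAIGHT BLOCK-LINE AVERAGE `Qstr` (comb reading of the
# transported straight segments) AND «S_W = D_U μ + E» AT ONE LEVEL: `‖Qbar L W Y − Qstr L W Y‖ ≤ 16(d+1)(d+4)L²a · (local ℓ¹ of Y)`,
# hence on T(W) `‖Qstr L W Y + gaugeDir (cavg L W) (Fbar L W Y)‖ ≤ (same)`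

NE3 formalisation swarm `b2b-balaban-t4-ne3-formalise-*`, LEAF PROVER 04 (gen 4), row **C1** of the owner's cut of the (w4)-P core
(`t4-ne3-p1-g21`, RULING ρ-g21-2 ∕ design note `HOME/t4/b2b-balaban-t4-ne3-p1/g21/D-ne3p1-g21-1.md` §3 (C1), §4: «covariant line sums
S_W (comb reading) and S_W = D_U μ + E from w4-S — leaf-04»; CLAIM in HOME/CLAIMS.log 2026-08-20 ≈15:02Z).  ONE LEVEL, from the tree BY NAME:
* `BlockAverageDbarLinBound.segMain` (the transported straight segments `Σ_x L^{−d} Ad_{W(Γ_{c₋,x})} δ_Y W([x, x + L e_κ])`, B7 (125)) and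
  `BlockAverageDbarLinBound.norm_dbarLin_sub_main_le` (`‖dbarLin − Ad_{V̄⁻¹} segMain‖ ≤ w·(local ℓ¹)` in the `w`-ball of the loop variables);
* `B7Prop2Explicit.norm_Wcx_sub_one_le` (the loop variables are within `w = 16(d+1)(d+4)L²a ≤ 1∕32` of `1` in the small-field class);
* this unit's w4-S `NE3TangentCovariantStructure.cpush_eq_Qbar_add_gaugeDir` (`cpush = Qbar + gaugeDir (cavg W) Fbar`).

CONTENT (all [folklore]; 0 sorry; DATA defs `Qstr` (coarse reading of `Ad_{V̄⁻¹} segMain`) and `locL1` (the local ℓ¹ weight) → async audit):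
* `wBall_le` — `512(d+1)(d+4)L²a ≤ 1 ⇒ 16(d+1)(d+4)L²a ≤ 1∕32`; `norm_Wcx_sub_one_le_wBall`;
* **`norm_Qbar_sub_Qstr_le`** — `‖Qbar L W Y z κ − Qstr L W Y z κ‖ ≤ 16(d+1)(d+4)L²a · locL1 L Y (L•z) κ` (unitary small-field `W`);
* `norm_Qstr_le` — `‖Qstr L W Y z κ‖ ≤ segL1 L Y (L•z) κ` (`Ad` isometric);
* **`norm_Qstr_sub_cpush_add_gaugeDir_le`** — `‖Qstr L W Y z κ − (cpush L W Y z κ − gaugeDir (cavg L W) (Fbar L W Y) z κ)‖ ≤ (same)`: the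
  straight covariant block-line average IS the linearised average minus the coarse gauge direction of the frames, up to `O(L²a)·ℓ¹`;
* **`norm_Qstr_add_gaugeDir_le_of_cpush_eq_zero`** — on `T(W)` at one level (`cpush L W Y = 0`, i.e. `TangentIter L 0 W Y`):
  `‖Qstr L W Y z κ + gaugeDir (cavg L W) (Fbar L W Y) z κ‖ ≤ 16(d+1)(d+4)L²a · locL1 L Y (L•z) κ` — the owner's «S_W = D_U μ + E» at k = 1
  with `μ = Fbar L W Y` read through `gaugeDir` (= `−D_U`, end-framed) and `E` bounded by the LOCAL ℓ¹ weight of `Y` on the double block.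
File 2 (this lineage, next): the tower `QstrIter` vs `QbarIter` (errors `O(d·L²·radIter j a)` per level, propagated through ℓ¹-density
contractions; total `O(d·M²a)`), giving `QstrIter = −gaugeDir (cavgIter k W) (framePotW k W Y) + E_k` on T(W) from `NE3TangentCovariantTower`.

HONEST: one-level covariant kinematics on OUR frame ([Balaban1985Averaging] (120)–(125) pp. 35–36, context only); nothing about minimisers,
(P_W), (ML_w), T-E_w or NE3 is asserted; NE3 NOT proved; spine 0∕9; finite T⁴ rung (B)+1 — NOT infinite volume, NOT mass gap, NOT BetaPertH,
NOT Clay.  PLACEMENT: `Summits/QuantumFields/BalabanUV/`.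
-/

set_option autoImplicit false

open scoped BigOperators Matrix.Norms.L2Operator
open Finset

namespace Summit.QuantumFields.BalabanUV.T4Continuum.NE3CovariantLineSums

open Literature.MathematicalPhysics.QuantumFieldTheory.Balaban1983to89
open B7Prop1Explicit B7Prop2Explicit
open T4AveragingDeficitWall (IsUnitaryCfg IsSkewDir SmallField Ad)
open AveragingDeficitTransport (lnorm norm_Ad_of_unitary mem_U1_of_unitary)
open AveragingDeficitChartCalculus (cavg)
open AveragingDeficitMultiLevelPrep (cpush)
open BlockAveragePushDirGauge (gaugeDir)
open BlockAveragePushDirSplit (dbarLin)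
open BlockAverageDbarLinBound (segMain loopL1 treeL1' segL1 norm_segMain_le norm_dbarLin_sub_main_le)
open NE3TangentCovariantStructure (Qbar Fbar cpush_eq_Qbar_add_gaugeDir)

noncomputable section

variable {d : ℕ} {n : Type*} [Fintype n] [DecidableEq n]

/-! ## §1 The straight covariant block-line average and the local ℓ¹ weight -/

/-- THE STRAIGHT COVARIANT BLOCK-LINE AVERAGE read on the coarse unit lattice: `Qstr L W Y (z,κ) := Ad_{V̄(c)⁻¹} segMain L W Y (L•z) κ`,
`c = (L•z, κ)` — the block average of the straight segments `[x, x + L e_κ]` transported to the corner through the comb (tree · segment),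
then to the end frame of the averaged bond (B7 (125), the MAIN TERM of the double-bar average). [cite: Balaban1985Averaging, (125) p.36] -/
def Qstr (L : ℕ) (W : Site d → Fin d → (Matrix n n ℂ)ˣ) (Y : Site d → Fin d → Matrix n n ℂ) : Site d → Fin d → Matrix n n ℂ :=
  fun z κ => Ad (bavg L W ((L : ℤ) • z) κ)⁻¹ (segMain L W Y ((L : ℤ) • z) κ)

/-- THE LOCAL ℓ¹ WEIGHT of a direction at the coarse bond `(q, κ)` (the error currency of `norm_dbarLin_sub_main_le`):
`1250·(loopL1 + ℓ_Γ) + 8·treeL1′ + 2·ℓ_Γ`, `ℓ_Γ = Σ_{b ⊂ [q, q + L e_κ]} ‖Y(b)‖`. [folklore] -/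
def locL1 (L : ℕ) (Y : Site d → Fin d → Matrix n n ℂ) (q : Site d) (κ : Fin d) : ℝ :=
  1250 * (loopL1 L Y q κ + lnorm Y q (seg κ L)) + 8 * treeL1' L Y q κ + 2 * lnorm Y q (seg κ L)

omit [Fintype n] [DecidableEq n] in
/-- The small-field clause gives the `1∕32`-ball: `512(d+1)(d+4)L²a ≤ 1 ⇒ 16(d+1)(d+4)L²a ≤ 1∕32`. [folklore] -/
theorem wBall_le {L : ℕ} {a : ℝ} (hsmall : 512 * (d + 1) * (d + 4) * (L : ℝ) ^ 2 * a ≤ 1) :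
    16 * (d + 1) * (d + 4) * (L : ℝ) ^ 2 * a ≤ 1 / 32 := by
  linarith

/-- The loop variables of the average are within `16(d+1)(d+4)L²a` of `1` throughout the small-field class
(`B7Prop2Explicit.norm_Wcx_sub_one_le`). [cite: Balaban1985Averaging, p.25] -/
theorem norm_Wcx_sub_one_le_wBall [Nonempty n] {L : ℕ} (hL : 1 ≤ L) {W : Site d → Fin d → (Matrix n n ℂ)ˣ} (hWu : IsUnitaryCfg W)
    {a : ℝ} (ha : 0 ≤ a) (hsmall : 512 * (d + 1) * (d + 4) * (L : ℝ) ^ 2 * a ≤ 1) (hWa : SmallField W a)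
    (q : Site d) (κ : Fin d) (r : Fin d → Fin L) :
    ‖((Wcx L W q κ (boxVec L r) : (Matrix n n ℂ)ˣ) : Matrix n n ℂ) - 1‖ ≤ 16 * (d + 1) * (d + 4) * (L : ℝ) ^ 2 * a := by
  have h := norm_Wcx_sub_one_le L hL W (fun x κ' => mem_U1_of_unitary (hWu x κ')) ha hsmall hWa q κ r
  linarith

/-! ## §2 `Qbar = Qstr + O(L²a)·ℓ¹`, and «S_W = D_U μ + E» at one level -/

/-- **THE DOUBLE-BAR AVERAGE IS THE STRAIGHT COVARIANT BLOCK-LINE AVERAGE UP TO `O(L²a)·ℓ¹`**: for unitary small-field `W`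
(`512(d+1)(d+4)L²a ≤ 1`, `SmallField W a`), `‖Qbar L W Y z κ − Qstr L W Y z κ‖ ≤ 16(d+1)(d+4)L²a · locL1 L Y (L•z) κ`
(the tree's `norm_dbarLin_sub_main_le` at the explicit ball). [cite: Balaban1985Averaging, (125) p.36] -/
theorem norm_Qbar_sub_Qstr_le [Nonempty n] {L : ℕ} (hL : 1 ≤ L) {W : Site d → Fin d → (Matrix n n ℂ)ˣ} (hWu : IsUnitaryCfg W)
    {a : ℝ} (ha : 0 ≤ a) (hsmall : 512 * (d + 1) * (d + 4) * (L : ℝ) ^ 2 * a ≤ 1) (hWa : SmallField W a)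
    (Y : Site d → Fin d → Matrix n n ℂ) (z : Site d) (κ : Fin d) :
    ‖Qbar L W Y z κ - Qstr L W Y z κ‖ ≤ (16 * (d + 1) * (d + 4) * (L : ℝ) ^ 2 * a) * locL1 L Y ((L : ℤ) • z) κ := by
  unfold Qbar Qstr locL1
  exact norm_dbarLin_sub_main_le L hL hWu Y _ κ (wBall_le hsmall)
    (fun r => norm_Wcx_sub_one_le_wBall hL hWu ha hsmall hWa _ κ r)

/-- `‖Qstr L W Y z κ‖ ≤ segL1 L Y (L•z) κ` (the transports are isometries). [folklore] -/
theorem norm_Qstr_le [Nonempty n] {L : ℕ} (hL : 1 ≤ L) {W : Site d → Fin d → (Matrix n n ℂ)ˣ} (hWu : IsUnitaryCfg W)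
    {a : ℝ} (ha : 0 ≤ a) (hsmall : 512 * (d + 1) * (d + 4) * (L : ℝ) ^ 2 * a ≤ 1) (hWa : SmallField W a)
    (Y : Site d → Fin d → Matrix n n ℂ) (z : Site d) (κ : Fin d) :
    ‖Qstr L W Y z κ‖ ≤ segL1 L Y ((L : ℤ) • z) κ := by
  letI : CStarAlgebra (Matrix n n ℂ) := {}
  have hW4 : ∀ r : Fin d → Fin L, ‖((Wcx L W ((L : ℤ) • z) κ (boxVec L r) : (Matrix n n ℂ)ˣ) : Matrix n n ℂ) - 1‖ ≤ 1 / 4 :=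
    fun r => (norm_Wcx_sub_one_le_wBall hL hWu ha hsmall hWa _ κ r).trans ((wBall_le hsmall).trans (by norm_num))
  have hb : bavg L W ((L : ℤ) • z) κ ∈ unitaryUnits (Matrix n n ℂ) := bavg_mem_unitaryUnits hWu L _ κ hW4
  unfold Qstr
  rw [norm_Ad_of_unitary ((unitaryUnits (Matrix n n ℂ)).inv_mem hb)]
  exact norm_segMain_le L hWu Y _ κ

/-- **THE STRAIGHT COVARIANT BLOCK-LINE AVERAGE = LINEARISED AVERAGE − FRAME GAUGE DIRECTION, up to `O(L²a)·ℓ¹`**: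
`‖Qstr L W Y z κ − (cpush L W Y z κ − gaugeDir (cavg L W) (Fbar L W Y) z κ)‖ ≤ 16(d+1)(d+4)L²a · locL1 L Y (L•z) κ`
(w4-S split `cpush = Qbar + gaugeDir (cavg W) Fbar` + `norm_Qbar_sub_Qstr_le`). [folklore] -/
theorem norm_Qstr_sub_cpush_add_gaugeDir_le [Nonempty n] {L : ℕ} (hL : 1 ≤ L) {W : Site d → Fin d → (Matrix n n ℂ)ˣ}
    (hWu : IsUnitaryCfg W) {a : ℝ} (ha : 0 ≤ a) (hsmall : 512 * (d + 1) * (d + 4) * (L : ℝ) ^ 2 * a ≤ 1) (hWa : SmallField W a)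
    (Y : Site d → Fin d → Matrix n n ℂ) (z : Site d) (κ : Fin d) :
    ‖Qstr L W Y z κ - (cpush L W Y z κ - gaugeDir (cavg L W) (Fbar L W Y) z κ)‖
      ≤ (16 * (d + 1) * (d + 4) * (L : ℝ) ^ 2 * a) * locL1 L Y ((L : ℤ) • z) κ := by
  rw [cpush_eq_Qbar_add_gaugeDir, add_sub_cancel_right, norm_sub_rev]
  exact norm_Qbar_sub_Qstr_le hL hWu ha hsmall hWa Y z κ

/-- **«S_W = D_U μ + E» AT ONE LEVEL**: on the one-level tangent space (`cpush L W Y = 0`, i.e. `TangentIter L 0 W Y`) the straight covariant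
block-line average is the coarse gauge direction generated by MINUS the linearised frames, up to the local ℓ¹ error:
`‖Qstr L W Y z κ + gaugeDir (cavg L W) (Fbar L W Y) z κ‖ ≤ 16(d+1)(d+4)L²a · locL1 L Y (L•z) κ`. [cite: Balaban1985Averaging, (120)–(125) pp.35–36] -/
theorem norm_Qstr_add_gaugeDir_le_of_cpush_eq_zero [Nonempty n] {L : ℕ} (hL : 1 ≤ L) {W : Site d → Fin d → (Matrix n n ℂ)ˣ}
    (hWu : IsUnitaryCfg W) {a : ℝ} (ha : 0 ≤ a) (hsmall : 512 * (d + 1) * (d + 4) * (L : ℝ) ^ 2 * a ≤ 1) (hWa : SmallField W a)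
    {Y : Site d → Fin d → Matrix n n ℂ} (hT : cpush L W Y = 0) (z : Site d) (κ : Fin d) :
    ‖Qstr L W Y z κ + gaugeDir (cavg L W) (Fbar L W Y) z κ‖
      ≤ (16 * (d + 1) * (d + 4) * (L : ℝ) ^ 2 * a) * locL1 L Y ((L : ℤ) • z) κ := by
  have h := norm_Qstr_sub_cpush_add_gaugeDir_le hL hWu ha hsmall hWa Y z κ
  rw [hT] at h
  simpa [sub_eq_add_neg] using h

end

end Summit.QuantumFields.BalabanUV.T4Continuum.NE3CovariantLineSums
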